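import Literature.Geometry.Lorentzian.ChartDomainComparison
import Mathlib.MeasureTheory.Function.Jacobian
import HarnessLib

/-!
# Integration over pieces of a composite chart `Ψ ∘ φ` (chart followed by a Euclidean
# diffeomorphism): change of variables and the pinched density

Topic `Geometry/Riemannian`. Theorem file (no definitions, no named facts; everything proved).
Let `h` be a (`Cⁿ`) Riemannian metric on a manifold `N` modelled on `ℝᵐ`, `φ = extChartAt I x` an
extended chart and `Ψ` a partial homeomorphism of `ℝᵐ` with `Ψ.source ⊆ φ.target`, differentiable
with differentiable inverse (a Euclidean change of coordinates ON TOP of the chart, e.g. the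
straightening of a level set, `Analysis/Calculus/LevelSetStraightening.lean`). For the composite
coordinates `w = Ψ (φ p)` the Riemannian measure has the density

`ρ(w) = |det D(Ψ⁻¹)(w)| √(det h_{ij}(Ψ⁻¹ w))`

with respect to Lebesgue measure (Chavel 2006, §III.3, (III.3.5)–(III.3.6) combined with the
Euclidean change of variables formula, Mathlib's `lintegral_image_eq_lintegral_abs_det_fderiv_mul`):

* `setLIntegral_compositeChart`, `setIntegral_compositeChart` — for a measurable `B ⊆ Ψ.target`,
  `∫_{φ⁻¹(Ψ⁻¹ B)} u dμ_h = ∫_B ρ(w) u(φ⁻¹(Ψ⁻¹ w)) dw` (Lebesgue and Bochner forms);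
* `det_fderiv_symm_mul_det_fderiv`, `det_fderiv_symm_ne_zero` — `det D(Ψ⁻¹)(w) · det DΨ(Ψ⁻¹ w) = 1`;
* `continuousOn_compositeDensity`, `compositeDensity_pos`, `exists_compositeDensity_bounds` —
  `ρ` is continuous and positive on `Ψ.target` and pinched between positive constants on compact
  subsets.

Used by the Poincaré inequality and the weak Neumann problem on regular sublevel domains
(discharge path of `Literature.Geometry.Riemannian.sharpLogSobolevAVR_four`).

## References

* I. Chavel, *Riemannian Geometry: A Modern Introduction*, 2nd ed. (2006), §III.3,
  (III.3.5)–(III.3.6). [Chavel2006]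
* H. Federer, *Geometric Measure Theory* (1969), §3.2.3, §3.2.46. [Federer1969]
-/

noncomputable section

open Set Function Filter MeasureTheory Measure TopologicalSpace Manifold Bundle
open scoped Manifold ContDiff Topology ENNReal NNReal

namespace Literature.Geometry.Riemannian

open Lorentzian

variable {H : Type*} [TopologicalSpace H] {n : ℕ∞ω} {m : ℕ}
  {I : ModelWithCorners ℝ (EuclideanSpace ℝ (Fin m)) H}
  {N : Type*} [TopologicalSpace N] [ChartedSpace H N] [IsManifold I 1 N]

/-! ### The Jacobian of the inverse -/

section Jacobian

/-- For a partial homeomorphism `Ψ` of `ℝᵐ` differentiable at `Ψ⁻¹ w` with `Ψ⁻¹` differentiable at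
`w ∈ Ψ.target`: `D Ψ(Ψ⁻¹ w) ∘ D(Ψ⁻¹)(w) = id`. [folklore] -/
theorem fderiv_comp_fderiv_symm {Ψ : OpenPartialHomeomorph (EuclideanSpace ℝ (Fin m))
    (EuclideanSpace ℝ (Fin m))} {w : EuclideanSpace ℝ (Fin m)} (hw : w ∈ Ψ.target)
    (hΨ : DifferentiableAt ℝ Ψ (Ψ.symm w)) (hΨ' : DifferentiableAt ℝ Ψ.symm w) :
    (fderiv ℝ Ψ (Ψ.symm w)).comp (fderiv ℝ Ψ.symm w) =
      ContinuousLinearMap.id ℝ (EuclideanSpace ℝ (Fin m)) := by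
  have hev : (fun w' => Ψ (Ψ.symm w')) =ᶠ[𝓝 w] id := by
    filter_upwards [Ψ.open_target.mem_nhds hw] with w' hw'
    exact Ψ.right_inv hw'
  have h1 : HasFDerivAt (fun w' => Ψ (Ψ.symm w')) ((fderiv ℝ Ψ (Ψ.symm w)).comp (fderiv ℝ Ψ.symm w)) w :=
    hΨ.hasFDerivAt.comp w hΨ'.hasFDerivAt
  have h2 : HasFDerivAt (fun w' => Ψ (Ψ.symm w')) (ContinuousLinearMap.id ℝ _) w :=
    (hasFDerivAt_id w).congr_of_eventuallyEq hev
  exact h1.unique h2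

/-- `det D(Ψ⁻¹)(w) · det DΨ(Ψ⁻¹ w) = 1` on `Ψ.target`. [folklore] -/
theorem det_fderiv_symm_mul_det_fderiv {Ψ : OpenPartialHomeomorph (EuclideanSpace ℝ (Fin m))
    (EuclideanSpace ℝ (Fin m))} {w : EuclideanSpace ℝ (Fin m)} (hw : w ∈ Ψ.target)
    (hΨ : DifferentiableAt ℝ Ψ (Ψ.symm w)) (hΨ' : DifferentiableAt ℝ Ψ.symm w) :
    (fderiv ℝ Ψ.symm w).det * (fderiv ℝ Ψ (Ψ.symm w)).det = 1 := by
  have h := congr_arg ContinuousLinearMap.det (fderiv_comp_fderiv_symm hw hΨ hΨ')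
  simp only [ContinuousLinearMap.det, ContinuousLinearMap.coe_id, LinearMap.det_id,
    ContinuousLinearMap.toLinearMap_comp, LinearMap.det_comp] at h
  rw [mul_comm]
  exact h

/-- `det D(Ψ⁻¹)(w) ≠ 0` on `Ψ.target`. [folklore] -/
theorem det_fderiv_symm_ne_zero {Ψ : OpenPartialHomeomorph (EuclideanSpace ℝ (Fin m))
    (EuclideanSpace ℝ (Fin m))} {w : EuclideanSpace ℝ (Fin m)} (hw : w ∈ Ψ.target)
    (hΨ : DifferentiableAt ℝ Ψ (Ψ.symm w)) (hΨ' : DifferentiableAt ℝ Ψ.symm w) :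
    (fderiv ℝ Ψ.symm w).det ≠ 0 := by
  intro h0
  have h := det_fderiv_symm_mul_det_fderiv hw hΨ hΨ'
  rw [h0, zero_mul] at h
  exact zero_ne_one h

/-- The image `Ψ⁻¹(B)` of a measurable `B ⊆ Ψ.target` is measurable and lies in `Ψ.source`.
[folklore] -/
theorem measurableSet_symm_image {Ψ : OpenPartialHomeomorph (EuclideanSpace ℝ (Fin m))
    (EuclideanSpace ℝ (Fin m))} (hΨ' : DifferentiableOn ℝ Ψ.symm Ψ.target)
    {B : Set (EuclideanSpace ℝ (Fin m))} (hBm : MeasurableSet B) (hB : B ⊆ Ψ.target) :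
    MeasurableSet (Ψ.symm '' B) ∧ Ψ.symm '' B ⊆ Ψ.source := by
  have hinj : InjOn Ψ.symm B := Ψ.symm.injOn.mono (by rw [Ψ.symm_source]; exact hB)
  have hD : ∀ w ∈ B, HasFDerivWithinAt Ψ.symm (fderiv ℝ Ψ.symm w) B w := fun w hw =>
    ((hΨ' w (hB hw)).differentiableAt (Ψ.open_target.mem_nhds (hB hw))).hasFDerivAt.hasFDerivWithinAt
  have hme := measurableEmbedding_of_fderivWithin hBm hD hinj
  refine ⟨?_, fun y ⟨w, hw, hwy⟩ => hwy ▸ Ψ.map_target (hB hw)⟩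
  have : Ψ.symm '' B = range (B.restrict Ψ.symm) := by
    rw [Set.range_restrict]
  rw [this]
  exact hme.measurableSet_range

end Jacobian

/-! ### Change of variables to composite coordinates -/

section Integral

variable [T3Space N] [MeasurableSpace N] [BorelSpace N]
  (h : ContMDiffRiemannianMetric I n (EuclideanSpace ℝ (Fin m)) (TangentSpace I : N → Type _))
  (x : N)

/-- **Change of variables to composite coordinates, Lebesgue integral.** Let `φ = extChartAt I x`,
`Ψ` a partial homeomorphism of `ℝᵐ` with `Ψ.source ⊆ φ.target` and `Ψ⁻¹` differentiable on
`Ψ.target`, and `B ⊆ Ψ.target` measurable. For every measurable `u : N → [0, ∞]`,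
`∫_{φ.source ∩ φ⁻¹(Ψ⁻¹ B)} u dμ_h = ∫_B |det D(Ψ⁻¹)(w)| √(det h_{ij}(Ψ⁻¹ w)) u(φ⁻¹(Ψ⁻¹ w)) dw`
(the chart formula (III.3.6) and the Euclidean change of variables `y = Ψ⁻¹ w`).
[cite: Chavel2006, §III.3 (III.3.6)] -/
theorem setLIntegral_compositeChart {Ψ : OpenPartialHomeomorph (EuclideanSpace ℝ (Fin m))
    (EuclideanSpace ℝ (Fin m))} (hΨt : Ψ.source ⊆ (extChartAt I x).target)
    (hΨ' : DifferentiableOn ℝ Ψ.symm Ψ.target) {B : Set (EuclideanSpace ℝ (Fin m))}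
    (hBm : MeasurableSet B) (hB : B ⊆ Ψ.target) {u : N → ℝ≥0∞} (hu : Measurable u) :
    ∫⁻ p in (extChartAt I x).source ∩ extChartAt I x ⁻¹' (Ψ.symm '' B), u p ∂riemannianMeasure h =
      ∫⁻ w in B, ENNReal.ofReal |(fderiv ℝ Ψ.symm w).det| *
        (u ((extChartAt I x).symm (Ψ.symm w)) *
          ENNReal.ofReal (Real.sqrt (chartGramMatrix h x (Ψ.symm w)).det)) := by
  have hinj : InjOn Ψ.symm B := Ψ.symm.injOn.mono (by rw [Ψ.symm_source]; exact hB)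
  have hD : ∀ w ∈ B, HasFDerivWithinAt Ψ.symm (fderiv ℝ Ψ.symm w) B w := fun w hw =>
    ((hΨ' w (hB hw)).differentiableAt (Ψ.open_target.mem_nhds (hB hw))).hasFDerivAt.hasFDerivWithinAt
  obtain ⟨hQm, hQs⟩ := measurableSet_symm_image hΨ' hBm hB
  rw [setLIntegral_source_inter_preimage_extChartAt' h x hu hQm (hQs.trans hΨt),
    lintegral_image_eq_lintegral_abs_det_fderiv_mul volume hBm hD hinj]

/-- **Change of variables to composite coordinates, Bochner integral** (real-valued functions):
with the notation of `setLIntegral_compositeChart`, for every measurable `u : N → ℝ`,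
`∫_{φ.source ∩ φ⁻¹(Ψ⁻¹ B)} u dμ_h = ∫_B (|det D(Ψ⁻¹)(w)| √(det h_{ij}(Ψ⁻¹ w))) u(φ⁻¹(Ψ⁻¹ w)) dw`
(both sides `0` if not integrable). [cite: Chavel2006, §III.3 (III.3.6)] -/
theorem setIntegral_compositeChart {Ψ : OpenPartialHomeomorph (EuclideanSpace ℝ (Fin m))
    (EuclideanSpace ℝ (Fin m))} (hΨt : Ψ.source ⊆ (extChartAt I x).target)
    (hΨ' : DifferentiableOn ℝ Ψ.symm Ψ.target) {B : Set (EuclideanSpace ℝ (Fin m))}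
    (hBm : MeasurableSet B) (hB : B ⊆ Ψ.target) {u : N → ℝ} (hu : Measurable u) :
    ∫ p in (extChartAt I x).source ∩ extChartAt I x ⁻¹' (Ψ.symm '' B), u p ∂riemannianMeasure h =
      ∫ w in B, (|(fderiv ℝ Ψ.symm w).det| * Real.sqrt (chartGramMatrix h x (Ψ.symm w)).det) *
        u ((extChartAt I x).symm (Ψ.symm w)) := by
  set φ := extChartAt I x with hφ
  have hinj : InjOn Ψ.symm B := Ψ.symm.injOn.mono (by rw [Ψ.symm_source]; exact hB)
  have hD : ∀ w ∈ B, HasFDerivWithinAt Ψ.symm (fderiv ℝ Ψ.symm w) B w := fun w hw =>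
    ((hΨ' w (hB hw)).differentiableAt (Ψ.open_target.mem_nhds (hB hw))).hasFDerivAt.hasFDerivWithinAt
  obtain ⟨hQm, hQs⟩ := measurableSet_symm_image hΨ' hBm hB
  set Q := Ψ.symm '' B with hQ
  have hQt : Q ⊆ φ.target := hQs.trans hΨt
  have hs : MeasurableSet φ.source := (isOpen_extChartAt_source x).measurableSet
  have hSQ : MeasurableSet (φ.source ∩ φ ⁻¹' Q) := measurableSet_source_inter_preimage_extChartAt x hQm
  -- Step 1: to the chart `φ`
  have h1 : ∫ p in φ.source ∩ φ ⁻¹' Q, u p ∂riemannianMeasure h =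
      ∫ y in Q, Real.sqrt (chartGramMatrix h x y).det * u (φ.symm y) := by
    have e1 : ∫ p in φ.source ∩ φ ⁻¹' Q, u p ∂riemannianMeasure h =
        ∫ p in φ.source, (Q.indicator (u ∘ φ.symm)) (φ p) ∂riemannianMeasure h := by
      rw [← integral_indicator hSQ, ← integral_indicator hs]
      refine integral_congr_ae (Eventually.of_forall fun p => ?_)
      by_cases hp : p ∈ φ.source
      · rw [indicator_of_mem hp]
        by_cases hq : φ p ∈ Q
        · rw [indicator_of_mem (show p ∈ _ ∩ _ from ⟨hp, hq⟩), indicator_of_mem hq,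
            Function.comp_apply, φ.left_inv hp]
        · rw [indicator_of_notMem (fun h' => hq h'.2), indicator_of_notMem hq]
      · rw [indicator_of_notMem (fun h' => hp h'.1), indicator_of_notMem hp]
    have hmeas : AEStronglyMeasurable (Q.indicator (u ∘ φ.symm))
        ((volume : Measure (EuclideanSpace ℝ (Fin m))).restrict φ.target) :=
      ((hu.comp_aemeasurable (aemeasurable_extChartAt_symm_restrict x)).indicator hQm).aestronglyMeasurable
    rw [e1, setIntegral_extChartAt_comp h x hmeas]
    have e2 : ∀ y, Real.sqrt (chartGramMatrix h x y).det • Q.indicator (u ∘ φ.symm) y =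
        Q.indicator (fun y => Real.sqrt (chartGramMatrix h x y).det * u (φ.symm y)) y := fun y => by
      by_cases hy : y ∈ Q
      · rw [indicator_of_mem hy, indicator_of_mem hy, smul_eq_mul, Function.comp_apply]
      · rw [indicator_of_notMem hy, indicator_of_notMem hy, smul_zero]
    simp_rw [e2]
    rw [integral_indicator hQm, Measure.restrict_restrict hQm, inter_eq_left.2 hQt]
  rw [h1, hQ, integral_image_eq_integral_abs_det_fderiv_smul volume hBm hD hinj]
  refine integral_congr_ae (Eventually.of_forall fun w => ?_)
  simp only [smul_eq_mul]
  ring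

/-! ### The composite density -/

omit [T3Space N] [MeasurableSpace N] [BorelSpace N] in
/-- **The composite density is continuous** on `Ψ.target` when `Ψ⁻¹` is `C¹` there. [folklore] -/
theorem continuousOn_compositeDensity {Ψ : OpenPartialHomeomorph (EuclideanSpace ℝ (Fin m))
    (EuclideanSpace ℝ (Fin m))} (hΨt : Ψ.source ⊆ (extChartAt I x).target)
    (hΨ' : ContDiffOn ℝ 1 Ψ.symm Ψ.target) :
    ContinuousOn (fun w => |(fderiv ℝ Ψ.symm w).det| *
      Real.sqrt (chartGramMatrix h x (Ψ.symm w)).det) Ψ.target := by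
  have h1 : ContinuousOn (fun w => fderiv ℝ Ψ.symm w) Ψ.target :=
    hΨ'.continuousOn_fderiv_of_isOpen Ψ.open_target le_rfl
  have h2 : ContinuousOn (fun w => |(fderiv ℝ Ψ.symm w).det|) Ψ.target :=
    (ContinuousLinearMap.continuous_det.comp_continuousOn h1).abs
  have h3 : ContinuousOn (fun w => Real.sqrt (chartGramMatrix h x (Ψ.symm w)).det) Ψ.target :=
    (continuousOn_sqrt_det_chartGramMatrix h x).comp Ψ.continuousOn_symm
      (fun w hw => hΨt (Ψ.map_target hw))
  exact h2.mul h3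

omit [T3Space N] [MeasurableSpace N] [BorelSpace N] in
/-- **The composite density is positive** on `Ψ.target` (invertible Jacobian, positive definite
Gram matrix). [folklore] -/
theorem compositeDensity_pos {Ψ : OpenPartialHomeomorph (EuclideanSpace ℝ (Fin m))
    (EuclideanSpace ℝ (Fin m))} (hΨt : Ψ.source ⊆ (extChartAt I x).target)
    (hΨ : DifferentiableOn ℝ Ψ Ψ.source) (hΨ' : DifferentiableOn ℝ Ψ.symm Ψ.target)
    {w : EuclideanSpace ℝ (Fin m)} (hw : w ∈ Ψ.target) :
    0 < |(fderiv ℝ Ψ.symm w).det| * Real.sqrt (chartGramMatrix h x (Ψ.symm w)).det := by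
  have hy : Ψ.symm w ∈ Ψ.source := Ψ.map_target hw
  have hdet := det_fderiv_symm_ne_zero hw
    ((hΨ _ hy).differentiableAt (Ψ.open_source.mem_nhds hy))
    ((hΨ' w hw).differentiableAt (Ψ.open_target.mem_nhds hw))
  exact mul_pos (abs_pos.2 hdet) (sqrt_det_chartGramMatrix_pos h x (hΨt hy))

omit [T3Space N] [MeasurableSpace N] [BorelSpace N] in
/-- **The composite density is pinched on compact parts of `Ψ.target`**: `λ ≤ ρ ≤ Λ` on a compact
`K ⊆ Ψ.target`, `0 < λ`. [folklore] -/
theorem exists_compositeDensity_bounds {Ψ : OpenPartialHomeomorph (EuclideanSpace ℝ (Fin m))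
    (EuclideanSpace ℝ (Fin m))} (hΨt : Ψ.source ⊆ (extChartAt I x).target)
    (hΨ : DifferentiableOn ℝ Ψ Ψ.source) (hΨ' : ContDiffOn ℝ 1 Ψ.symm Ψ.target)
    {K : Set (EuclideanSpace ℝ (Fin m))} (hK : IsCompact K) (hKt : K ⊆ Ψ.target) :
    ∃ lam Lam : ℝ, 0 < lam ∧ lam ≤ Lam ∧ ∀ w ∈ K,
      lam ≤ |(fderiv ℝ Ψ.symm w).det| * Real.sqrt (chartGramMatrix h x (Ψ.symm w)).det ∧
        |(fderiv ℝ Ψ.symm w).det| * Real.sqrt (chartGramMatrix h x (Ψ.symm w)).det ≤ Lam := by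
  have hc := (continuousOn_compositeDensity h x hΨt hΨ').mono hKt
  have hd : DifferentiableOn ℝ Ψ.symm Ψ.target := hΨ'.differentiableOn one_ne_zero
  by_cases hne : K.Nonempty
  · obtain ⟨w₀, hw₀, hmin⟩ := hK.exists_isMinOn hne hc
    obtain ⟨w₁, hw₁, hmax⟩ := hK.exists_isMaxOn hne hc
    exact ⟨_, _, compositeDensity_pos h x hΨt hΨ hd (hKt hw₀), hmin hw₁,
      fun w hw => ⟨hmin hw, hmax hw⟩⟩
  · exact ⟨1, 1, one_pos, le_rfl, fun w hw => absurd ⟨w, hw⟩ hne⟩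

/-- **Measure of a composite-chart piece**: for measurable `B ⊆ Ψ.target`,
`μ_h(φ.source ∩ φ⁻¹(Ψ⁻¹ B)) = ∫_B ρ dw`. [cite: Chavel2006, §III.3 (III.3.5)] -/
theorem riemannianMeasure_compositeChart_piece {Ψ : OpenPartialHomeomorph (EuclideanSpace ℝ (Fin m))
    (EuclideanSpace ℝ (Fin m))} (hΨt : Ψ.source ⊆ (extChartAt I x).target)
    (hΨ' : DifferentiableOn ℝ Ψ.symm Ψ.target) {B : Set (EuclideanSpace ℝ (Fin m))}
    (hBm : MeasurableSet B) (hB : B ⊆ Ψ.target) :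
    riemannianMeasure h ((extChartAt I x).source ∩ extChartAt I x ⁻¹' (Ψ.symm '' B)) =
      ∫⁻ w in B, ENNReal.ofReal (|(fderiv ℝ Ψ.symm w).det| *
        Real.sqrt (chartGramMatrix h x (Ψ.symm w)).det) := by
  have h1 := setLIntegral_compositeChart h x hΨt hΨ' hBm hB (u := fun _ => 1) measurable_const
  rw [setLIntegral_const, one_mul] at h1
  rw [h1]
  refine lintegral_congr_ae (Eventually.of_forall fun w => ?_)
  show ENNReal.ofReal |(fderiv ℝ Ψ.symm w).det| * (1 * ENNReal.ofReal √(chartGramMatrix h x (Ψ.symm w)).det) =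
    ENNReal.ofReal (|(fderiv ℝ Ψ.symm w).det| * √(chartGramMatrix h x (Ψ.symm w)).det)
  rw [one_mul, ENNReal.ofReal_mul (abs_nonneg _)]

/-- **A composite-chart piece over a relatively compact part of `Ψ.target` has finite measure.**
[folklore] -/
theorem riemannianMeasure_compositeChart_piece_lt_top {Ψ : OpenPartialHomeomorph
    (EuclideanSpace ℝ (Fin m)) (EuclideanSpace ℝ (Fin m))} (hΨt : Ψ.source ⊆ (extChartAt I x).target)
    (hΨ : DifferentiableOn ℝ Ψ Ψ.source) (hΨ' : ContDiffOn ℝ 1 Ψ.symm Ψ.target)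
    {B K : Set (EuclideanSpace ℝ (Fin m))} (hBm : MeasurableSet B) (hBK : B ⊆ K)
    (hK : IsCompact K) (hKt : K ⊆ Ψ.target) :
    riemannianMeasure h ((extChartAt I x).source ∩ extChartAt I x ⁻¹' (Ψ.symm '' B)) < ⊤ := by
  obtain ⟨lam, Lam, -, -, hb⟩ := exists_compositeDensity_bounds h x hΨt hΨ hΨ' hK hKt
  rw [riemannianMeasure_compositeChart_piece h x hΨt (hΨ'.differentiableOn one_ne_zero) hBm (hBK.trans hKt)]
  calc ∫⁻ w in B, ENNReal.ofReal (|(fderiv ℝ Ψ.symm w).det| *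
        Real.sqrt (chartGramMatrix h x (Ψ.symm w)).det)
      ≤ ∫⁻ _ in B, ENNReal.ofReal Lam :=
        setLIntegral_mono measurable_const fun w hw => ENNReal.ofReal_le_ofReal (hb w (hBK hw)).2
    _ = ENNReal.ofReal Lam * volume B := setLIntegral_const _ _
    _ < ⊤ := ENNReal.mul_lt_top ENNReal.ofReal_lt_top
        ((measure_mono hBK).trans_lt hK.measure_lt_top)

end Integral

end Literature.Geometry.Riemannian

end
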